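import Summits.AtomisticToContinuum.Crystallization.Theorems.ChargedEnergyGapDietStation
import HarnessLib

/-!
# Charged energy gap — NODE 113D «EikonalSplit»: the eikonal disjunction at the centre of the stencil

Support file for `PricedLinkCensus.ChargedEnergyGap` (sub-problem `Crystallization` of `AtomisticToContinuum`),
a COVER-LEVEL lemma for the census of (T¹ᶜ) (lens-3 g93, finding «SHELL-93»).

`IsChartRealisable ρ dt` (NODE 92 `…StencilChart`) gives every stencil point `p` a UNIT direction `u` with the six rows
`2·dt p·⟪P_q − P_p, u⟫ ≤ ‖P_q − P_p‖² + dt p² − dt q²`.  Every LINEAR consequence used so far (the S2 rows of NODE 110D, the pair and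
Lipschitz rows) only exploits `‖u‖ ≤ 1`.  At the CENTRE the condition `‖u‖ = 1` has a further, non-convex consequence: writing
`Γ_q := ρ² + dt 0² − dt q²` for the six neighbours `q = holeVertex 0 (a, b)`, the centre rows read `± 2·dt 0·ρ·u_a ≤ Γ_{(a,b)}`, and
`Σ_a u_a² = 1` forces, for ANY thresholds `c : Fin 3 → ℝ≥0` with `c 0² + c 1² + c 2² ≤ 1`, SOME axis `a` and pole `b` with
`2·dt 0·ρ·c a ≤ Γ_{(a,b)}` (`eikonal_branch`).  In the axis chamber (`dt (a,T) ≤ dt (a,F)`) the pole is the `T` pole, and with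
`ρ ∈ [ρ0, ρ1]` the branch becomes the LINEAR row `dt (a,T)² − dt 0² + 2·c a·ρ0·dt 0 ≤ ρ1²` in the station's LP coordinates
(`eikonal_branch_row`): a three-way case split the cover can take, each branch adding one pool row to the station certificates.
§113D.3 is the station side: the checker `checkDX` = 113B `checkD` with a list of EXTRA HYPOTHESIS ROWS appended to the pool, its soundness
`sound_dietX` (the extra rows' validity at the tuple is an explicit hypothesis), the branch row `eikRow` as pool data with `linAt_eikRow`, and
the branch-station soundness `sound_dietEik` (imports lane 113B «DietStation»).
-/

namespace Summit.AtomisticToContinuum.Crystallization.Theorems.ChargedEnergyGapChartDial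

open scoped Classical
open Literature.MathematicalPhysics.StatisticalMechanics Literature.Geometry.DiscreteGeometry
open Summit.AtomisticToContinuum.Crystallization.Theses.PricedLinkCensus
open Summit.AtomisticToContinuum.Crystallization.Theorems.ChargedEnergyGapNegative

/-! ## §113D.1 The centre rows in coordinates -/
section CentreRows

/-- [formal bookkeeping] coordinates of a hole vertex of the centre: `(holeVertex 0 (a,b))ₖ = poleSign b · [k = a]`. -/
theorem holeVertex_zero_apply (a k : Fin 3) (b : Bool) : holeVertex 0 (a, b) k = if k = a then poleSign b else 0 := by
  simp [holeVertex, axisZ, Pi.add_apply]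

/-- ★ [formal bookkeeping] the centre's realisability row towards the neighbour `(a, b)` in coordinates:
`2·dt 0·ρ·(poleSign b·u_a) ≤ ρ² + dt 0² − dt (holeVertex 0 (a,b))²`. -/
theorem realisRow_centre_vertex {ρ : ℝ} {dt : (Fin 3 → ℤ) → ℝ} {u : E3} (a : Fin 3) (b : Bool)
    (h : realisRow ρ dt 0 (holeVertex 0 (a, b)) u) :
    2 * dt 0 * ρ * ((poleSign b : ℝ) * u a) ≤ ρ ^ 2 + dt 0 ^ 2 - dt (holeVertex 0 (a, b)) ^ 2 := by
  rw [realisRow_iff_coord] at h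
  have e : ∀ k : Fin 3, ((holeVertex 0 (a, b) k - (0 : Fin 3 → ℤ) k : ℤ) : ℝ) = if k = a then (poleSign b : ℝ) else 0 := by
    intro k
    rw [holeVertex_zero_apply]
    split_ifs <;> simp
  simp only [e] at h
  have hs1 : ∑ k : Fin 3, (if k = a then (poleSign b : ℝ) else 0) * u k = (poleSign b : ℝ) * u a := by
    rw [Finset.sum_eq_single a (fun k _ hk => by simp [hk]) (fun hk => absurd (Finset.mem_univ a) hk)]
    simp
  have hs2 : ∑ k : Fin 3, (if k = a then (poleSign b : ℝ) else 0) ^ 2 = 1 := by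
    rw [Finset.sum_eq_single a (fun k _ hk => by simp [hk]) (fun hk => absurd (Finset.mem_univ a) hk)]
    cases b <;> simp [poleSign]
  rw [hs1, hs2, mul_one] at h
  linarith

end CentreRows

/-! ## §113D.2 The eikonal disjunction -/
section Eikonal

/-- ★★★ **THE EIKONAL BRANCH LEMMA**: for thresholds `c` with `c 0² + c 1² + c 2² ≤ 1`, some neighbour `(a, b)` of the centre satisfies
`2·dt 0·ρ·c a ≤ ρ² + dt 0² − dt (holeVertex 0 (a,b))²`.  (If every neighbour failed, the centre's unit direction `u` would have
`|u_a| < c a` for all three axes, hence `‖u‖² < 1`.) -/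
theorem eikonal_branch {ρ : ℝ} {dt : (Fin 3 → ℤ) → ℝ} (h : IsChartRealisable ρ dt) (hC : 0 ≤ dt 0) (hρ : 0 ≤ ρ)
    (c : Fin 3 → ℝ) (hsum : c 0 ^ 2 + c 1 ^ 2 + c 2 ^ 2 ≤ 1) :
    ∃ a : Fin 3, ∃ b : Bool, 2 * dt 0 * ρ * c a ≤ ρ ^ 2 + dt 0 ^ 2 - dt (holeVertex 0 (a, b)) ^ 2 := by
  obtain ⟨u, hu, hrow⟩ := h 0 (mem_stencil_self 0)
  have hr : ∀ (a : Fin 3) (b : Bool), 2 * dt 0 * ρ * ((poleSign b : ℝ) * u a) ≤ ρ ^ 2 + dt 0 ^ 2 - dt (holeVertex 0 (a, b)) ^ 2 :=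
    fun a b => realisRow_centre_vertex a b (hrow _ (mem_stencil_vertex 0 (a, b)))
  by_contra hne
  push Not at hne
  have key : ∀ a : Fin 3, 2 * dt 0 * ρ * |u a| < 2 * dt 0 * ρ * c a := by
    intro a
    rcases le_or_gt 0 (u a) with hua | hua
    · have h1 := hr a true
      have h2 := hne a true
      simp only [poleSign, if_true, Int.cast_one, one_mul] at h1
      rw [abs_of_nonneg hua]
      linarith
    · have h1 := hr a false
      have h2 := hne a false
      simp only [poleSign, Bool.false_eq_true, if_false, Int.cast_neg, Int.cast_one, neg_mul, one_mul] at h1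
      rw [abs_of_neg hua]
      linarith
  have h2pos : 0 ≤ 2 * dt 0 * ρ := by positivity
  have hpos : 0 < 2 * dt 0 * ρ := by
    rcases h2pos.lt_or_eq with hlt | heq
    · exact hlt
    · have := key 0
      rw [← heq] at this
      simp at this
  have hlt : ∀ a : Fin 3, |u a| < c a := fun a => lt_of_mul_lt_mul_left (key a) h2pos
  have hsq : ∀ a : Fin 3, u a ^ 2 < c a ^ 2 := fun a => by
    have h1 := hlt a
    have h0 := abs_nonneg (u a)
    nlinarith [sq_abs (u a)]
  have hnorm : u 0 ^ 2 + u 1 ^ 2 + u 2 ^ 2 = 1 := by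
    have e := EuclideanSpace.real_norm_sq_eq u
    rw [hu, Fin.sum_univ_three] at e
    simp only [one_pow] at e
    linarith
  linarith [hsq 0, hsq 1, hsq 2]

/-- ★★★ **THE EIKONAL BRANCH ROW** (chamber form, `ρ` eliminated): in the axis chamber `dt (a,T) ≤ dt (a,F)`, with a tuple positive on the stencil
and `ρ0 ≤ ρ ≤ ρ1`, `0 ≤ ρ0`, for thresholds `c ≥ 0` with `c 0² + c 1² + c 2² ≤ 1` SOME axis `a` satisfies the LINEAR row
`dt (holeVertex 0 (a,T))² − dt 0² + 2·c a·ρ0·dt 0 ≤ ρ1²` — the row a station certificate of branch `a` adds to its pool. -/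
theorem eikonal_branch_row {ρ ρ0 ρ1 : ℝ} {dt : (Fin 3 → ℤ) → ℝ} (h : IsChartRealisable ρ dt) (h0 : ρ0 ≤ ρ) (h1 : ρ ≤ ρ1) (hρ0 : 0 ≤ ρ0)
    (hpos : ∀ p ∈ stencil 0, 0 < dt p) (hTF : ∀ a : Fin 3, dt (holeVertex 0 (a, true)) ≤ dt (holeVertex 0 (a, false)))
    (c : Fin 3 → ℝ) (hc : ∀ a, 0 ≤ c a) (hsum : c 0 ^ 2 + c 1 ^ 2 + c 2 ^ 2 ≤ 1) :
    ∃ a : Fin 3, dt (holeVertex 0 (a, true)) ^ 2 - dt 0 ^ 2 + 2 * c a * ρ0 * dt 0 ≤ ρ1 ^ 2 := by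
  have hC : 0 ≤ dt 0 := (hpos 0 (mem_stencil_self 0)).le
  have hρ : 0 ≤ ρ := hρ0.trans h0
  obtain ⟨a, b, hab⟩ := eikonal_branch h hC hρ c hsum
  refine ⟨a, ?_⟩
  have hT0 : 0 < dt (holeVertex 0 (a, true)) := hpos _ (mem_stencil_vertex 0 (a, true))
  have hsqT : dt (holeVertex 0 (a, true)) ^ 2 ≤ dt (holeVertex 0 (a, b)) ^ 2 := by
    cases b
    · exact pow_le_pow_left₀ hT0.le (hTF a) 2
    · exact le_rfl
  have hca : 0 ≤ c a := hc a
  have hm : 2 * c a * ρ0 * dt 0 ≤ 2 * dt 0 * ρ * c a := by nlinarith [mul_nonneg hca hC]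
  have hρ1 : ρ ^ 2 ≤ ρ1 ^ 2 := pow_le_pow_left₀ hρ h1 2
  linarith

/-- ★ The EQUAL-THRESHOLD instance `c ≡ 4/7` (`3·(4/7)² = 48/49 ≤ 1`): some axis `a` has `dt (a,T)² − dt 0² + (8/7)·ρ0·dt 0 ≤ ρ1²`. -/
theorem eikonal_branch_row_47 {ρ ρ0 ρ1 : ℝ} {dt : (Fin 3 → ℤ) → ℝ} (h : IsChartRealisable ρ dt) (h0 : ρ0 ≤ ρ) (h1 : ρ ≤ ρ1) (hρ0 : 0 ≤ ρ0)
    (hpos : ∀ p ∈ stencil 0, 0 < dt p) (hTF : ∀ a : Fin 3, dt (holeVertex 0 (a, true)) ≤ dt (holeVertex 0 (a, false))) :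
    ∃ a : Fin 3, dt (holeVertex 0 (a, true)) ^ 2 - dt 0 ^ 2 + (8 / 7) * ρ0 * dt 0 ≤ ρ1 ^ 2 := by
  obtain ⟨a, ha⟩ := eikonal_branch_row h h0 h1 hρ0 hpos hTF (fun _ => 4 / 7) (fun _ => by norm_num) (by norm_num)
  exact ⟨a, by linarith⟩

end Eikonal

/-! ## §113D.3 Station side: extra hypothesis rows and the branch row -/
section Station

/-- ★ THE DIET CHECKER WITH EXTRA HYPOTHESIS ROWS (chamber form): 113B `checkD` with `extra` appended to the pool. -/
def StationCert.checkDX (c : StationCert) (X : DietCert) (extra : List LRow) : Bool :=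
  c.R.ok && decide (0 < c.R.rho0 ∧ 0 ≤ c.R.loC) && c.boxes.all c.boxCheck &&
    c.caps.all (fun l => (c.capCertL l).capCheck 0) && c.capCert.capCheck 0 && X.ok c.R &&
    c.tree.checkBox c.needD c.R.bnd (c.R.rows ++ chamberRows ++ X.rows ++ extra)

/-- ★★★ **SOUNDNESS WITH EXTRA ROWS**: as 113B `sound_diet`, for tuples at which every extra row holds (an explicit hypothesis the cover discharges
from its case split). -/
theorem StationCert.sound_dietX (c : StationCert) (X : DietCert) (extra : List LRow) (h : c.checkDX X extra = true) :
    ∀ ρ : ℝ, (c.R.rho0 : ℝ) ≤ ρ → ρ ≤ c.R.rho1 → ∀ dt : (Fin 3 → ℤ) → ℝ,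
      (∀ q, castW c.R.lo q ≤ dt (holeVertex 0 q) ∧ dt (holeVertex 0 q) ≤ castW c.R.hi q) → ((c.R.loC : ℝ) ≤ dt 0 ∧ dt 0 ≤ c.R.hiC) →
      IsChartRealisable ρ dt → (∀ p ∈ stencil 0, 0 < dt p) → poleSum dt 0 ≤ poleSum dt 1 → poleSum dt 0 ≤ poleSum dt 2 →
      (∀ a : Fin 3, dt (holeVertex 0 (a, true)) ≤ dt (holeVertex 0 (a, false))) → (∀ r ∈ extra, linAt r.a (sval dt) 0 ≤ (r.b : ℝ)) →
      feetHoleCost 160 (3 / 100) ρ dt 0 ≤ domCapK c.u 160 (3 / 100) ρ (chargeDepth ρ dt 0) := by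
  simp only [StationCert.checkDX, Bool.and_eq_true, decide_eq_true_eq, List.all_eq_true] at h
  obtain ⟨⟨⟨⟨⟨⟨hok, hρ0, hloC⟩, hboxes⟩, hcaps⟩, hc0⟩, hX⟩, htree⟩ := h
  intro ρ h₀ h₁ dt hbox hC hreal hpos hch1 hch2 hchp hextra
  have hρ : 0 < ρ := lt_of_lt_of_le (by exact_mod_cast hρ0) h₀
  have hbox' : ∀ q, (c.R.lo q : ℝ) ≤ dt (holeVertex 0 q) ∧ dt (holeVertex 0 q) ≤ c.R.hi q := fun q => by simpa [castW_apply] using hbox q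
  have h7 := c.R.box7 hbox' hC
  obtain ⟨hsl, hnn⟩ := c.diet_prelim hok hloC
  have hrows : ∀ r ∈ c.R.rows ++ chamberRows ++ X.rows ++ extra, linAt r.a (sval dt) 0 ≤ (r.b : ℝ) := fun r hr => by
    rcases List.mem_append.1 hr with hr | hr
    · rcases List.mem_append.1 hr with hr | hr
      · rcases List.mem_append.1 hr with hr | hr
        · exact c.R.rows_sound hok h₀ h₁ hbox' hC hreal hpos r hr
        · exact chamberRows_sound dt hch1 hch2 hchp r hr
      · exact X.rows_sound hX hsl h7 r hr
    · exact hextra r hr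
  obtain ⟨π, hπ⟩ := c.tree.sound_box c.needD c.R.bnd (sval dt) (c.R.bnd_sound h7 hnn) _ htree hrows
  refine c.sound_leaf (fun k => k.capCheck 0 = true) hboxes hcaps hc0 hρ h₁ hbox (fun k e0 e1 eu k0 hb => ?_) hπ
  have hdom := capCheck_zero_chamber k0 hρ (e0 ▸ h₀ :) (e1 ▸ h₁ :) hb hch1 hch2
  rwa [eu] at hdom

/-- ★ THE BRANCH ROW as pool data (valuation indices: depth `0` = centre, square `7 + slotIx (a,T)`, square `7` = centre):
`D_(a,T) − D_C + 2·cq·ρ0·x_C ≤ ρ1²`. -/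
def eikRow (a : Fin 3) (cq ρ0 ρ1 : ℚ) : LRow :=
  ⟨axpy 1 (unitRow (7 + slotIx (a, true)) 1) (axpy 1 (unitRow 7 (-1)) (unitRow 0 (2 * cq * ρ0))), ρ1 ^ 2⟩

/-- [formal bookkeeping] the branch row's form at the valuation of a tuple. -/
theorem linAt_eikRow (a : Fin 3) (cq ρ0 ρ1 : ℚ) (dt : (Fin 3 → ℤ) → ℝ) :
    linAt (eikRow a cq ρ0 ρ1).a (sval dt) 0 = dt (holeVertex 0 (a, true)) ^ 2 - dt 0 ^ 2 + 2 * (cq : ℝ) * ρ0 * dt 0 := by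
  have e1 : sval dt (7 + slotIx (a, true)) = dt (holeVertex 0 (a, true)) ^ 2 := by
    rw [show 7 + slotIx (a, true) = 7 + ptIx (some (a, true)) from rfl, sval_sq, stPt_some]
  have e2 : sval dt 7 = dt 0 ^ 2 := by rw [show (7 : ℕ) = 7 + ptIx none from rfl, sval_sq, stPt_none]
  have e3 : sval dt 0 = dt 0 := by rw [show (0 : ℕ) = ptIx none from rfl, sval_pt, stPt_none]
  simp only [eikRow, linAt_axpy, linAt_unitRow]
  rw [e1, e2, e3]
  push_cast
  ring

/-- ★ The branch hypothesis discharges the branch row. -/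
theorem eikRow_holds {a : Fin 3} {cq ρ0 ρ1 : ℚ} {dt : (Fin 3 → ℤ) → ℝ}
    (h : dt (holeVertex 0 (a, true)) ^ 2 - dt 0 ^ 2 + 2 * (cq : ℝ) * ρ0 * dt 0 ≤ (ρ1 : ℝ) ^ 2) :
    ∀ r ∈ [eikRow a cq ρ0 ρ1], linAt r.a (sval dt) 0 ≤ (r.b : ℝ) := by
  intro r hr
  rw [List.mem_singleton.1 hr, linAt_eikRow]
  simp only [eikRow]
  push_cast
  exact h

/-- ★★★ **SOUNDNESS OF A BRANCH STATION**: a station certificate checked with the branch row of axis `a` (threshold `cq`, the station's own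
`ρ`-range) proves (T¹ᶜ) for the FNF tuples of its box that lie in branch `a` — `dt (a,T)² − dt 0² + 2·cq·ρ0·dt 0 ≤ ρ1²`; the cover obtains
the branch from `eikonal_branch_row` with thresholds `c 0² + c 1² + c 2² ≤ 1` and one checked station per axis. -/
theorem StationCert.sound_dietEik (c : StationCert) (X : DietCert) (a : Fin 3) (cq : ℚ) (h : c.checkDX X [eikRow a cq c.R.rho0 c.R.rho1] = true) :
    ∀ ρ : ℝ, (c.R.rho0 : ℝ) ≤ ρ → ρ ≤ c.R.rho1 → ∀ dt : (Fin 3 → ℤ) → ℝ,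
      (∀ q, castW c.R.lo q ≤ dt (holeVertex 0 q) ∧ dt (holeVertex 0 q) ≤ castW c.R.hi q) → ((c.R.loC : ℝ) ≤ dt 0 ∧ dt 0 ≤ c.R.hiC) →
      IsChartRealisable ρ dt → (∀ p ∈ stencil 0, 0 < dt p) → poleSum dt 0 ≤ poleSum dt 1 → poleSum dt 0 ≤ poleSum dt 2 →
      (∀ a : Fin 3, dt (holeVertex 0 (a, true)) ≤ dt (holeVertex 0 (a, false))) →
      dt (holeVertex 0 (a, true)) ^ 2 - dt 0 ^ 2 + 2 * (cq : ℝ) * c.R.rho0 * dt 0 ≤ (c.R.rho1 : ℝ) ^ 2 →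
      feetHoleCost 160 (3 / 100) ρ dt 0 ≤ domCapK c.u 160 (3 / 100) ρ (chargeDepth ρ dt 0) :=
  fun ρ h₀ h₁ dt hbox hC hreal hpos hch1 hch2 hchp hbr =>
    c.sound_dietX X _ h ρ h₀ h₁ dt hbox hC hreal hpos hch1 hch2 hchp (eikRow_holds hbr)

/-- ★★★ **THE THREE-BRANCH DISPATCH** on one cell: three station certificates with a common `ρ`-range `[ρ0, ρ1]`, `0 ≤ ρ0`, checked with the
branch rows of axes `0, 1, 2` for thresholds `c` with `c a ≥ 0` and `c 0² + c 1² + c 2² ≤ 1`, prove (T¹ᶜ) for every FNF tuple lying in all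
three station boxes (the cover uses three copies of one cell box). -/
theorem StationCert.sound_eik3 (cs : Fin 3 → StationCert) (Xs : Fin 3 → DietCert) (c : Fin 3 → ℚ) (ρ0 ρ1 : ℚ) (hρ0 : 0 ≤ ρ0)
    (hc : ∀ a, 0 ≤ c a) (hsum : c 0 ^ 2 + c 1 ^ 2 + c 2 ^ 2 ≤ 1) (he0 : ∀ a, (cs a).R.rho0 = ρ0) (he1 : ∀ a, (cs a).R.rho1 = ρ1)
    (h : ∀ a, (cs a).checkDX (Xs a) [eikRow a (c a) ρ0 ρ1] = true) {u : ℚ} (hu : ∀ a, (cs a).u = u) :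
    ∀ ρ : ℝ, (ρ0 : ℝ) ≤ ρ → ρ ≤ ρ1 → ∀ dt : (Fin 3 → ℤ) → ℝ,
      (∀ a q, castW (cs a).R.lo q ≤ dt (holeVertex 0 q) ∧ dt (holeVertex 0 q) ≤ castW (cs a).R.hi q) →
      (∀ a, ((cs a).R.loC : ℝ) ≤ dt 0 ∧ dt 0 ≤ (cs a).R.hiC) →
      IsChartRealisable ρ dt → (∀ p ∈ stencil 0, 0 < dt p) → poleSum dt 0 ≤ poleSum dt 1 → poleSum dt 0 ≤ poleSum dt 2 →
      (∀ a : Fin 3, dt (holeVertex 0 (a, true)) ≤ dt (holeVertex 0 (a, false))) →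
      feetHoleCost 160 (3 / 100) ρ dt 0 ≤ domCapK u 160 (3 / 100) ρ (chargeDepth ρ dt 0) := by
  intro ρ h₀ h₁ dt hbox hC hreal hpos hch1 hch2 hchp
  obtain ⟨a, ha⟩ := eikonal_branch_row hreal h₀ h₁ (by exact_mod_cast hρ0) hpos hchp (fun a => (c a : ℝ)) (fun a => by exact_mod_cast hc a)
    (by exact_mod_cast hsum)
  have hh := h a
  rw [← he0 a, ← he1 a] at hh
  have := (cs a).sound_dietEik (Xs a) a (c a) hh ρ (by rw [he0]; exact h₀) (by rw [he1]; exact h₁) dt (hbox a) (hC a) hreal hpos hch1 hch2 hchp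
    (by rw [he0, he1]; exact ha)
  rwa [hu a] at this

end Station

end Summit.AtomisticToContinuum.Crystallization.Theorems.ChargedEnergyGapChartDial
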